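import Summits.CriticalPhenomena.SAWScalingLimit.Theorems.SAWDevelopingMapObservableToSLETypeLadderCarvedReductionSqueezeSelect
import Summits.CriticalPhenomena.SAWScalingLimit.Theorems.SAWDevelopingMapObservableToSLECanonicalTransferLatticeChains
import Summits.CriticalPhenomena.SAWScalingLimit.Theorems.SAWDefectDecoherenceObservableToSLERGateDefs
import Literature.Probability.Percolation.QuadCrossingRawClosed
import HarnessLib

/-!
# Limits of the pinned fat spines along a subsequence (piece (T-A lim-b) of stub T-A
# `stub_carvedReduction_squeezeGeometry`)

Crux `SAWDevelopingMap.ObservableToSLE` (stmt-CriticalPhenomena-10472), line `six-class-type-ladder`,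
stub T-A `stub_carvedReduction_squeezeGeometry`.  Landing target:
`Summits/CriticalPhenomena/SAWScalingLimit/Theorems/SAWDevelopingMapObservableToSLETypeLadderCarvedReductionSqueezeSpineLimits.lean`
(`--supports stmt-CriticalPhenomena-10472`).  Companion of `…SqueezeLevelLimits` (hexagons); uses
`…SqueezeSelect` (Blaschke selection, p133194).

THE LIMIT STRUCTURE OF THE REMOVED SETS, second half (memo item 2 of the T-A plan): the FAT SPINES.
Each solid level `L_j` carries a compact connected spine `K_j` through the rescaled root whose
closed `ρ/8`-neighbourhood is removed at vertex level (`infDist (s_j c_v) K_j ≤ ρ/8 → v ∈ L_j`), and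
every level vertex lies in a level hexagon dipping into the `ρ/16`-neighbourhood of `K_j`.  Read in
the pinned frame `z ↦ z - τ_j` (an isometry: all clauses transport verbatim), the spines lie in a
fixed disc (`R`-locality: every point of `K_j` is within a mesh of a removed vertex), so along a
subsequence they converge in the Hausdorff metric to a compact CONNECTED limit spine `Kinf` through
the limit pinned root (`spine_limits`), and the CORE IS PERSISTENTLY REMOVED: eventually every
vertex whose pinned centre is within `ρ/8 - ε` of `Kinf` belongs to the level.
Registered carrier: `stub_carvedReduction_isometry_sub_const`.
-/

noncomputable section

open scoped Topology
open Filter Set Metric TopologicalSpace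
open Literature.Probability.LatticeModels (HexVertex hexGraph hexCenter Site)
open Literature.Probability.RandomPlanarGeometry
open Literature.Probability.Percolation.QuadCrossing (mem_of_tendsto_of_hausdorffDist_tendsto
  isPreconnected_of_hausdorffDist_tendsto)

namespace Summit.CriticalPhenomena.SAWScalingLimit.Theorems.ObservableToSLE.TypeLadder

open Summit.CriticalPhenomena.SAWScalingLimit.Theorems.ObservableToSLER.BridgeGate
open Summit.CriticalPhenomena.SAWScalingLimit.Theorems.ObservableToSLE.FloorRatio (exists_vertex_dist_le)

/-! ### Pinning is an isometry -/

/-- Translation by `-c` is an isometry of `ℂ`. -/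
theorem isometry_sub_const (c : ℂ) : Isometry fun z : ℂ => z - c :=
  Isometry.of_dist_eq fun x y => by rw [dist_sub_right]

/-- **Registered sub-goal `stub_carvedReduction_isometry_sub_const`** (crux item
stmt-CriticalPhenomena-10472, stub T-A `stub_carvedReduction_squeezeGeometry`, piece (T-A lim-b)). -/
theorem stub_carvedReduction_isometry_sub_const : ∀ c : ℂ, Isometry fun z : ℂ => z - c :=
  isometry_sub_const

/-- Distances to a pinned set are distances to the set. -/
theorem infDist_sub_image (c z : ℂ) (K : Set ℂ) :
    infDist (z - c) ((fun w : ℂ => w - c) '' K) = infDist z K :=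
  infDist_image (isometry_sub_const c)

/-! ### The limits -/

/-- **LIMITS OF THE PINNED FAT SPINES**; see the module docstring.  Hypotheses: meshes `s j > 0`,
`s j → 0`; levels `L j`, `R`-local about `root j`; fat spines `K` (compact, connected, through the
rescaled root, closed `ρ/8`-neighbourhood removed, every level vertex in a level hexagon dipping
into the `ρ/16`-neighbourhood); pinned roots `s_j c_{root j} - τ j → ℓ₀`.  Conclusion: a subsequence
`ψ`, the pinned spines `Kp j` (same clauses, pinned) converging in the Hausdorff metric to a compact
connected `Kinf ∋ ℓ₀` inside `closedBall ℓ₀ (R + 1)`, and the persistence of the core. -/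
theorem spine_limits {s : ℕ → ℝ} {τ : ℕ → ℂ} {L : ℕ → Set HexVertex} {root : ℕ → HexVertex}
    {R ρ : ℝ} {ℓ₀ : ℂ} (hρ : 0 < ρ) (hspos : ∀ j, 0 < s j) (hs0 : Tendsto s atTop (𝓝 0))
    (hloc : ∀ j, ∀ v ∈ L j, dist ((s j : ℂ) * hexCenter v) ((s j : ℂ) * hexCenter (root j)) ≤ R)
    (hfat : ∀ j, ∃ K : Set ℂ, IsCompact K ∧ IsConnected K ∧ (s j : ℂ) * hexCenter (root j) ∈ K ∧
      (∀ v : HexVertex, infDist ((s j : ℂ) * hexCenter v) K ≤ ρ / 8 → v ∈ L j) ∧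
      (∀ v ∈ L j, ∃ (t w : HexVertex) (r : ℕ), v ∈ hexBall t r ∧ w ∈ hexBall t r ∧
        hexBall t r ⊆ L j ∧ infDist ((s j : ℂ) * hexCenter w) K ≤ ρ / 16))
    (hrootlim : Tendsto (fun j => (s j : ℂ) * hexCenter (root j) - τ j) atTop (𝓝 ℓ₀)) :
    ∃ (ψ : ℕ → ℕ) (Kinf : Set ℂ) (Kp : ℕ → Set ℂ), StrictMono ψ ∧
      IsCompact Kinf ∧ IsConnected Kinf ∧ ℓ₀ ∈ Kinf ∧ Kinf ⊆ closedBall ℓ₀ (R + 1) ∧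
      (∀ j, IsCompact (Kp j) ∧ IsConnected (Kp j) ∧
        (s (ψ j) : ℂ) * hexCenter (root (ψ j)) - τ (ψ j) ∈ Kp j ∧ Kp j ⊆ closedBall ℓ₀ (R + 1) ∧
        (∀ v : HexVertex, infDist ((s (ψ j) : ℂ) * hexCenter v - τ (ψ j)) (Kp j) ≤ ρ / 8 → v ∈ L (ψ j)) ∧
        (∀ v ∈ L (ψ j), ∃ (t w : HexVertex) (r : ℕ), v ∈ hexBall t r ∧ w ∈ hexBall t r ∧
          hexBall t r ⊆ L (ψ j) ∧ infDist ((s (ψ j) : ℂ) * hexCenter w - τ (ψ j)) (Kp j) ≤ ρ / 16)) ∧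
      Tendsto (fun j => hausdorffDist (Kp j) Kinf) atTop (𝓝 0) ∧
      (∀ ε > (0 : ℝ), ∀ᶠ j in atTop, ∀ v : HexVertex,
        infDist ((s (ψ j) : ℂ) * hexCenter v - τ (ψ j)) Kinf ≤ ρ / 8 - ε → v ∈ L (ψ j)) := by
  classical
  choose K hKc hKconn hKroot hKfat hKdip using hfat
  -- the pinned spines
  set Kq : ℕ → Set ℂ := fun j => (fun w : ℂ => w - τ j) '' K j with hKq
  have hKqc : ∀ j, IsCompact (Kq j) := fun j => (hKc j).image (continuous_id.sub continuous_const)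
  have hKqconn : ∀ j, IsConnected (Kq j) := fun j => (hKconn j).image _ (continuous_id.sub continuous_const).continuousOn
  have hKqroot : ∀ j, (s j : ℂ) * hexCenter (root j) - τ j ∈ Kq j := fun j => ⟨_, hKroot j, rfl⟩
  have hKqfat : ∀ j (v : HexVertex), infDist ((s j : ℂ) * hexCenter v - τ j) (Kq j) ≤ ρ / 8 → v ∈ L j := by
    intro j v hv
    rw [hKq] at hv; simp only at hv; rw [infDist_sub_image] at hv
    exact hKfat j v hv
  have hKqdip : ∀ j, ∀ v ∈ L j, ∃ (t w : HexVertex) (r : ℕ), v ∈ hexBall t r ∧ w ∈ hexBall t r ∧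
      hexBall t r ⊆ L j ∧ infDist ((s j : ℂ) * hexCenter w - τ j) (Kq j) ≤ ρ / 16 := by
    intro j v hv
    obtain ⟨t, w, r, h1, h2, h3, h4⟩ := hKdip j v hv
    refine ⟨t, w, r, h1, h2, h3, ?_⟩
    rw [hKq]; simp only; rw [infDist_sub_image]; exact h4
  -- the pinned spines lie in a fixed disc, eventually
  have hsmall : ∀ᶠ j in atTop, s j < min (ρ / 8) (1 / 2) := (tendsto_order.1 hs0).2 _ (lt_min (by positivity) (by norm_num))
  have hrootnear : ∀ᶠ j in atTop, dist ((s j : ℂ) * hexCenter (root j) - τ j) ℓ₀ < 1 / 2 :=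
    (tendsto_iff_dist_tendsto_zero.1 hrootlim).eventually (gt_mem_nhds (by norm_num))
  have hdisc : ∀ᶠ j in atTop, Kq j ⊆ closedBall ℓ₀ (R + 1) := by
    filter_upwards [hsmall, hrootnear] with j hsj hrj z hz
    obtain ⟨z₀, hz₀, rfl⟩ := hz
    obtain ⟨v, hv⟩ := exists_vertex_dist_le (hspos j) z₀
    have hvL : v ∈ L j := by
      refine hKfat j v ((infDist_le_dist_of_mem hz₀).trans (hv.trans ?_))
      linarith [hsj.trans_le (min_le_left _ _)]
    have h1 := hloc j v hvL
    rw [mem_closedBall]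
    calc dist (z₀ - τ j) ℓ₀ ≤ dist (z₀ - τ j) ((s j : ℂ) * hexCenter (root j) - τ j) +
          dist ((s j : ℂ) * hexCenter (root j) - τ j) ℓ₀ := dist_triangle _ _ _
      _ = dist z₀ ((s j : ℂ) * hexCenter (root j)) + dist ((s j : ℂ) * hexCenter (root j) - τ j) ℓ₀ := by
          rw [dist_sub_right]
      _ ≤ (dist z₀ ((s j : ℂ) * hexCenter v) + dist ((s j : ℂ) * hexCenter v) ((s j : ℂ) * hexCenter (root j))) +
          dist ((s j : ℂ) * hexCenter (root j) - τ j) ℓ₀ := add_le_add (dist_triangle _ _ _) le_rfl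
      _ ≤ (s j + R) + 1 / 2 := by
          refine add_le_add (add_le_add ?_ h1) hrj.le
          rw [dist_comm]; exact hv
      _ ≤ R + 1 := by linarith [hsj.trans_le (min_le_right _ _)]
  obtain ⟨j₀, hj₀⟩ := eventually_atTop.1 hdisc
  -- Blaschke selection for the shifted sequence
  set F : ℕ → Fin 1 → NonemptyCompacts ℂ := fun j _ =>
    ⟨⟨Kq (j₀ + j), hKqc (j₀ + j)⟩, ⟨_, hKqroot (j₀ + j)⟩⟩ with hF
  have hFK : ∀ j i, ((F j i : Set ℂ)) ⊆ closedBall ℓ₀ (R + 1) := fun j _ => hj₀ (j₀ + j) (by omega)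
  obtain ⟨ψ₁, Lim, hψ₁, hLim, hconv⟩ :=
    exists_subseq_tendsto_nonemptyCompacts_pi (isCompact_closedBall ℓ₀ (R + 1)) F hFK
  have hH := tendsto_hausdorffDist_of_tendsto hconv 0
  set Kinf : Set ℂ := (Lim 0 : Set ℂ) with hKinf
  have hFeq : ∀ j, ((F (ψ₁ j) 0 : Set ℂ)) = Kq (j₀ + ψ₁ j) := fun j => rfl
  simp_rw [hFeq] at hH
  have hfin : ∀ j, hausdorffEDist (Kq (j₀ + ψ₁ j)) Kinf ≠ ⊤ := fun j =>
    hausdorffEDist_ne_top_nonemptyCompacts (F (ψ₁ j) 0) (Lim 0)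
  -- the subsequence
  set ψ : ℕ → ℕ := fun j => j₀ + ψ₁ j with hψdef
  have hψ : StrictMono ψ := fun a b hab => by simp only [hψdef]; exact Nat.add_lt_add_left (hψ₁ hab) _
  -- the limit spine
  have hKinfc : IsCompact Kinf := (Lim 0).isCompact
  have hℓ₀ : ℓ₀ ∈ Kinf :=
    mem_of_tendsto_of_hausdorffDist_tendsto hKinfc.isClosed (Lim 0).nonempty hfin hH
      (fun j => hKqroot (j₀ + ψ₁ j)) (hrootlim.comp hψ.tendsto_atTop)
  have hKinfconn : IsConnected Kinf :=
    ⟨⟨ℓ₀, hℓ₀⟩, isPreconnected_of_hausdorffDist_tendsto hKinfc (fun j => (hKqconn (j₀ + ψ₁ j)).isPreconnected) hfin hH⟩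
  refine ⟨ψ, Kinf, fun j => Kq (ψ j), hψ, hKinfc, hKinfconn, hℓ₀, hLim 0, fun j => ⟨hKqc _, hKqconn _, hKqroot _,
    hj₀ _ (by simp only [hψdef]; omega), hKqfat _, hKqdip _⟩, hH, fun ε hε => ?_⟩
  -- persistence of the core
  have hev : ∀ᶠ j in atTop, hausdorffDist (Kq (j₀ + ψ₁ j)) Kinf < ε := (tendsto_order.1 hH).2 ε hε
  filter_upwards [hev] with j hj v hv
  refine hKqfat (ψ j) v ?_
  have h1 := infDist_le_infDist_add_hausdorffDist (x := (s (ψ j) : ℂ) * hexCenter v - τ (ψ j))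
    (s := Kinf) (t := Kq (j₀ + ψ₁ j)) (by rw [hausdorffEDist_comm]; exact hfin j)
  rw [hausdorffDist_comm] at h1
  change infDist ((s (ψ j) : ℂ) * hexCenter v - τ (ψ j)) (Kq (j₀ + ψ₁ j)) ≤ ρ / 8
  linarith

end Summit.CriticalPhenomena.SAWScalingLimit.Theorems.ObservableToSLE.TypeLadder

end
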